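import Summits.AnomalousDissipation.AnomalousDissipation.Theorems.SawtoothPulseCascadeK1LocalisedCascadeCanonicalBlocks

/-!
# K1loc, line `Spectral` / thin start — helper: CANONICAL BLOCKS, THE `max` FAMILY OF LOWER CUT-OFFS (sharper cut-off ratio)

Helper file of the prover lane on the crux `K1LocalisedCascade` (stmt-AnomalousDissipation-19491), route `SawtoothPulseCascade`
(S-B/S-C assembly seat; the LEDGER ASSEMBLY, arithmetic layer).  `…CanonicalBlocks` §1 uses the ADDITIVE lower cut-off
`Q₁^m = ⌊2u′Λ_m/v′⌋ + E`; when the feed threshold `E+1` is comparable to the block (`A`-class steps, escalation factor `κ`), the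
sum wastes the margin and the cut-off ratio `r* = (Q₁+Q₂)/(Q₂−Q₁)` explodes (e.g. 31 instead of 3).  This file records the
`max` family **`Q₁^m = max(⌊2u′Λ_m/v′⌋, Y₀)`** on the geometric blocks `Λ_m = Λ₀2^m`, `Q₂^m = ⌊q_nΛ_m/q_d⌋`: given a slope
bound `t = t_n/t_d` with `2u′/v′ ≤ t`, `Y₀ ≤ tΛ₀` and the separation `(q_n/q_d − t)Λ₀ ≥ 2` (all as integer inequalities),
* `canonMax_Q₁_le` — `Q₁^m ≤ tΛ_m`; `canonMax_Q₁_lt_Q₂` — `Q₁^m < Q₂^m`; `canonMax_feed` — `u′Λ_{m+1} ≤ v′(Q₁^m + 1)`;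
  `canonMax_Y` — `Y₀ + 1 ≤ Q₁^m + 1`; `canonMax_r_le` — `r_m ≤ ((t+β)Λ₀ + 1)/((β−t)Λ₀ − 1)`, `β = q_n/q_d`.
These are exactly the `Q₁`-facts consumed by the generic canonical steps (`…CanonicalRatioStepsQ`, `…CanonicalStripStepsQ`).
Pure arithmetic; no definitions; no statement about the crux. [cite: Grafakos2014, §3.1.3] [problem: turb]
-/

-- `Summit.<Summit>.<Problem>`: single-conjunct summit, the duplicate namespace segment is deliberate.
set_option linter.dupNamespace false

noncomputable section

namespace Summit.AnomalousDissipation.AnomalousDissipation.Theorems.SawtoothPulseCascade.K1Window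

/-- **The `max` lower cut-off is below `tL`** on any block value `L ≥ Λ₀`: `2u′t_d ≤ t_nv′` and `Y₀t_d ≤ t_nΛ₀` give
`max(⌊2u′L/v′⌋, Y₀) ≤ (t_n/t_d)L`. [folklore] -/
theorem canonMax_Q₁_le {u' v' Y₀ tn td Λ0 L : ℕ} (hv' : 0 < v') (htd : 0 < td) (h1 : 2 * u' * td ≤ tn * v')
    (h2 : Y₀ * td ≤ tn * Λ0) (hL : Λ0 ≤ L) :
    ((max (2 * u' * L / v') Y₀ : ℕ) : ℝ) ≤ (tn : ℝ) / td * L := by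
  have hv'r : (0 : ℝ) < v' := by exact_mod_cast hv'
  have htdr : (0 : ℝ) < td := by exact_mod_cast htd
  have h1r : 2 * (u' : ℝ) * td ≤ tn * v' := by exact_mod_cast h1
  have h2r : (Y₀ : ℝ) * td ≤ tn * Λ0 := by exact_mod_cast h2
  have hΛ : (Λ0 : ℝ) ≤ L := by exact_mod_cast hL
  have hL0 : (0 : ℝ) ≤ L := by positivity
  rw [Nat.cast_max]
  refine max_le ?_ ?_
  · have h := Nat.cast_div_le (m := 2 * u' * L) (n := v') (α := ℝ)
    refine h.trans ?_
    push_cast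
    have key : 2 * (u' : ℝ) ≤ tn * v' / td := by rw [le_div_iff₀ htdr]; linarith
    rw [div_le_iff₀ hv'r]
    calc 2 * (u' : ℝ) * L = (2 * u') * L := by ring
      _ ≤ (tn * v' / td) * L := mul_le_mul_of_nonneg_right key hL0
      _ = (tn : ℝ) / td * L * v' := by ring
  · rw [div_mul_eq_mul_div, le_div_iff₀ htdr]
    nlinarith [mul_le_mul_of_nonneg_left hΛ (by positivity : (0 : ℝ) ≤ tn)]

/-- **Separation on every block for the `max` family**: with `(q_n/q_d − t)Λ₀ ≥ 2` (as `t_nq_dΛ₀ + 2q_dt_d ≤ q_nt_dΛ₀`) and the two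
slope bounds, `max(⌊2u′Λ_m/v′⌋, Y₀) < ⌊q_nΛ_m/q_d⌋`. [folklore] -/
theorem canonMax_Q₁_lt_Q₂ {u' v' Y₀ tn td qn qd Λ0 : ℕ} (hv' : 0 < v') (htd : 0 < td) (hqd : 0 < qd)
    (h1 : 2 * u' * td ≤ tn * v') (h2 : Y₀ * td ≤ tn * Λ0) (h3 : tn * qd * Λ0 + 2 * qd * td ≤ qn * td * Λ0) (m : ℕ) :
    max (2 * u' * (Λ0 * 2 ^ m) / v') Y₀ < qn * (Λ0 * 2 ^ m) / qd := by
  -- in `ℝ`: `Q₁ ≤ tΛ_m ≤ βΛ_m − 2 < ⌊βΛ_m⌋`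
  have hqdr : (0 : ℝ) < qd := by exact_mod_cast hqd
  have htdr : (0 : ℝ) < td := by exact_mod_cast htd
  have hQ1 := canonMax_Q₁_le hv' htd h1 h2 (canon_blocks_ge Λ0 m) (u' := u')
  have h3r : (tn : ℝ) * qd * Λ0 + 2 * qd * td ≤ qn * td * Λ0 := by exact_mod_cast h3
  have hΛ : (Λ0 : ℝ) ≤ ((Λ0 * 2 ^ m : ℕ) : ℝ) := by exact_mod_cast canon_blocks_ge Λ0 m
  -- `(β − t)Λ_m ≥ (β − t)Λ₀ ≥ 2`
  have hgap : (tn : ℝ) / td * ((Λ0 * 2 ^ m : ℕ) : ℝ) + 2 ≤ (qn : ℝ) / qd * ((Λ0 * 2 ^ m : ℕ) : ℝ) := by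
    have hβt : (tn : ℝ) / td ≤ (qn : ℝ) / qd := by
      rw [div_le_div_iff₀ htdr hqdr]
      have hΛ0 : (1 : ℝ) ≤ Λ0 ∨ (Λ0 : ℝ) < 1 := le_or_gt 1 (Λ0 : ℝ)
      nlinarith [h3r, (by positivity : (0 : ℝ) ≤ 2 * qd * td)]
    have hbase : (tn : ℝ) / td * Λ0 + 2 ≤ (qn : ℝ) / qd * Λ0 := by
      rw [div_mul_eq_mul_div, div_mul_eq_mul_div, div_add' _ _ _ htdr.ne', div_le_div_iff₀ htdr hqdr]
      nlinarith
    nlinarith [mul_le_mul_of_nonneg_left (sub_nonneg.mpr hΛ) (sub_nonneg.mpr hβt)]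
  have hQ2 : (qn : ℝ) / qd * ((Λ0 * 2 ^ m : ℕ) : ℝ) - 1 ≤ ((qn * (Λ0 * 2 ^ m) / qd : ℕ) : ℝ) := by
    have h := Nat.lt_div_mul_add (a := qn * (Λ0 * 2 ^ m)) hqd
    have h' : ((qn * (Λ0 * 2 ^ m) : ℕ) : ℝ) < ((qn * (Λ0 * 2 ^ m) / qd * qd + qd : ℕ) : ℝ) := by exact_mod_cast h
    push_cast at h'
    rw [div_mul_eq_mul_div, sub_le_iff_le_add, div_le_iff₀ hqdr]
    push_cast
    nlinarith
  have : ((max (2 * u' * (Λ0 * 2 ^ m) / v') Y₀ : ℕ) : ℝ) < ((qn * (Λ0 * 2 ^ m) / qd : ℕ) : ℝ) := by linarith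
  exact_mod_cast this

/-- **The feed inclusion for the `max` family**: `u′Λ_{m+1} ≤ v′(max(⌊2u′Λ_m/v′⌋, Y₀) + 1)`. [folklore] -/
theorem canonMax_feed {u' v' : ℕ} (hv' : 0 < v') (Y₀ Λ0 m : ℕ) :
    u' * (Λ0 * 2 ^ (m + 1)) ≤ v' * (max (2 * u' * (Λ0 * 2 ^ m) / v') Y₀ + 1) := by
  have h := canon_feed hv' 0 Λ0 m (u' := u')
  simp only [add_zero] at h
  exact h.trans (Nat.mul_le_mul_left _ (Nat.add_le_add_right (le_max_left _ _) _))

/-- **The feed threshold for the `max` family**: `Y₀ + 1 ≤ Q₁^m + 1`. [folklore] -/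
theorem canonMax_Y (u' v' Y₀ Λ0 m : ℕ) : Y₀ + 1 ≤ max (2 * u' * (Λ0 * 2 ^ m) / v') Y₀ + 1 :=
  Nat.add_le_add_right (le_max_right _ _) _

/-- **The cut-off ratio for the `max` family**: `r_m = (Q₁+Q₂)/(Q₂−Q₁) ≤ ((t+β)Λ₀ + 1)/((β−t)Λ₀ − 1)` (`β = q_n/q_d`,
`t = t_n/t_d`), under the two slope bounds and the separation `(β − t)Λ₀ ≥ 2`. [folklore] -/
theorem canonMax_r_le {u' v' Y₀ tn td qn qd Λ0 : ℕ} (hv' : 0 < v') (htd : 0 < td) (hqd : 0 < qd)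
    (h1 : 2 * u' * td ≤ tn * v') (h2 : Y₀ * td ≤ tn * Λ0) (h3 : tn * qd * Λ0 + 2 * qd * td ≤ qn * td * Λ0) (m : ℕ) :
    (((max (2 * u' * (Λ0 * 2 ^ m) / v') Y₀ : ℕ) : ℝ) + ((qn * (Λ0 * 2 ^ m) / qd : ℕ) : ℝ)) /
        (((qn * (Λ0 * 2 ^ m) / qd : ℕ) : ℝ) - ((max (2 * u' * (Λ0 * 2 ^ m) / v') Y₀ : ℕ) : ℝ)) ≤
      (((tn : ℝ) / td + (qn : ℝ) / qd) * Λ0 + 1) / (((qn : ℝ) / qd - (tn : ℝ) / td) * Λ0 - 1) := by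
  have hqdr : (0 : ℝ) < qd := by exact_mod_cast hqd
  have htdr : (0 : ℝ) < td := by exact_mod_cast htd
  set Λ : ℕ := Λ0 * 2 ^ m with hΛdef
  set t : ℝ := (tn : ℝ) / td with ht
  set β : ℝ := (qn : ℝ) / qd with hβ
  set Q1 : ℝ := ((max (2 * u' * Λ / v') Y₀ : ℕ) : ℝ) with hQ1
  set Q2 : ℝ := ((qn * Λ / qd : ℕ) : ℝ) with hQ2
  have hQ1le : Q1 ≤ t * Λ := canonMax_Q₁_le hv' htd h1 h2 (canon_blocks_ge Λ0 m)
  have hQ10 : 0 ≤ Q1 := by positivity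
  have hQ2hi : Q2 ≤ β * Λ := canon_Q₂_le qn qd Λ
  have hQ2lo : β * Λ - 1 ≤ Q2 := by
    have h := Nat.lt_div_mul_add (a := qn * Λ) hqd
    have h' : ((qn * Λ : ℕ) : ℝ) < ((qn * Λ / qd * qd + qd : ℕ) : ℝ) := by exact_mod_cast h
    push_cast at h'
    rw [hβ, div_mul_eq_mul_div, sub_le_iff_le_add, div_le_iff₀ hqdr]
    nlinarith
  have hΛ : (Λ0 : ℝ) ≤ (Λ : ℝ) := by exact_mod_cast canon_blocks_ge Λ0 m
  have h3r : (tn : ℝ) * qd * Λ0 + 2 * qd * td ≤ qn * td * Λ0 := by exact_mod_cast h3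
  have hgap0 : t * Λ0 + 2 ≤ β * Λ0 := by
    rw [ht, hβ, div_mul_eq_mul_div, div_mul_eq_mul_div, div_add' _ _ _ htdr.ne', div_le_div_iff₀ htdr hqdr]
    nlinarith
  have hβt : 0 < β - t := by
    have : (0 : ℝ) ≤ Λ0 := by positivity
    by_contra h; push Not at h
    nlinarith
  have hgap : t * Λ + 2 ≤ β * Λ := by nlinarith [mul_le_mul_of_nonneg_left hΛ hβt.le]
  have hlt : (1 : ℝ) < (β - t) * Λ0 := by linarith
  -- `r ≤ ((t+β)Λ + 1)/((β−t)Λ − 1) ≤ the same at Λ₀`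
  have hden : 0 < (β - t) * Λ - 1 := by nlinarith
  have hd' : 0 < Q2 - Q1 := by nlinarith
  have step1 : (Q1 + Q2) / (Q2 - Q1) ≤ ((t + β) * Λ + 1) / ((β - t) * Λ - 1) := by
    rw [div_le_div_iff₀ hd' hden]
    have hnum : Q1 + Q2 ≤ (t + β) * Λ + 1 := by nlinarith
    have hden' : (β - t) * Λ - 1 ≤ Q2 - Q1 := by nlinarith
    have hnum0 : 0 ≤ Q1 + Q2 := by nlinarith
    nlinarith [mul_le_mul hnum hden' hden.le (by nlinarith)]
  refine step1.trans ?_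
  have hc1 : 0 ≤ t + β := by rw [ht, hβ]; positivity
  have := ratioClass_ratio_le (c₁ := t + β) (c₂ := β - t) (Q := (1 : ℝ)) hΛ hlt zero_le_one hc1 hβt
  simpa [mul_comm] using this

end Summit.AnomalousDissipation.AnomalousDissipation.Theorems.SawtoothPulseCascade.K1Window
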